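import Summits.CriticalPhenomena.PercolationContinuityZ3.Theorems.Transplant.GrigorchukWitnessSlabProfile
import HarnessLib

/-!
# Door D12, item T4: the engine E7 `SlabLogEngine o` PROVED — under a jump with vertical gluing at exponential height and stretched-exponential growth,
# `log X(𝔊 × [m, m+L]) ≥ c (log(L+2))^{a/(1−a)}` for all large `L`

Proof file (`--supports stmt-CriticalPhenomena-4575`), lane `prim-bschramm`, seat `prim-bschramm-gen-1` gen 11 (GEN pen); item T4 of the design desk's D12 typing spec
(p3 g41, bus 2026-08-29 #9231: "T4 SlabLogEngine :477 THEOREM (M): T3 + VertGluedIfJumpExp + GrowthLower + slabSusceptLE_anti_height + the j-optimisation — REUSE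
the lro_squeeze pattern with χ(p) ↦ X(L), n := ⌊log(L/2 − R₀)/C⌋").  builds on p205010 (kernel theorem, internal audit signed; external expert review pending) —
nothing in this file uses p205010.  Def-free; no instance, no notation, no sorry, no `@[conjecture]`; `SlabLogEngine o` is an IMPLICATION whose hypotheses
(growth exponent `a`, `VertGluedIfJumpExp o`, the jump `θ_o(p_c) > 0`) are NOT asserted; with T0's `doorD12_of_engine` this makes `DoorD12 a` a THEOREM for every
`a` — still a typed implication: nothing about `θ(p_c)` on either witness is claimed, `gzCay_conj4` stays OPEN.

THE ARGUMENT (E7).  Inputs: `exp(c₁ m^a) ≤ |B^𝔊(1,m)|` for `m ≥ m₁` (GrowthLower, eventual form); `κ_{R(n)}(n) ≥ q₀ := ¾θ²` with `R(n) = ⌈e^{Cn}⌉ + R₀`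
(VertGluedIfJumpExp under the jump); WLOG `C ≥ 1` (`slabKappa_mono`).  Given `L ≥ L₀`: `D := L/2 − R₀ ≥ (L+6)/4`, `n := ⌊log D / C⌋` so that `R(n) ≤ L/2`
and `n ≥ log(L+2)/(4C)`; `κ_{L/2}(n) ≥ q₀` (monotonicity in the height); T3 `slabProfileIneq` at `(L/2, n, j)` with `slabSusceptLE_anti_height`:
`B ≥ κ^j |B^𝔊(jn)| ≥ q₀^j exp(c₁ (jn)^a) = exp(c₁ j^a n^a − βj)`, `β = log(1/q₀) > 0`; the choice `j = ⌊κ₀ n^{a/(1−a)}⌋`, `κ₀^{1−a} = c₁/(2β)`, gives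
`βj ≤ ½c₁ j^a n^a` and `c₁ j^a n^a − βj ≥ ½c₁ (κ₀/2)^a n^{a/(1−a)} ≥ c (log(L+2))^{a/(1−a)}`.

CONTENT (namespace `…Transplant.Grigorchuk.SlabSuscept`): §1 real arithmetic `jopt_real`, `jopt` (the `j`-optimisation), `exp_mul_floor_le`, `le_floor_log_div`
(the link length `n`), `half_sub_control` (the half-height `L/2 − R₀`); §2 **`slabLogEngine (o : GZ) : SlabLogEngine o`** and **`doorD12 (a : ℝ) : DoorD12 a`**
(T0 `doorD12_of_engine`).  [cite: Hutchcroft2016, Lemma 4 (the lever κ^j·|B(jn)| ≤ χ)] [cite: BenjaminiSchramm1996, Conj. 4 (context: door D12)]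
[cite: Grigorchuk1984, Thm. (lower growth bound)]
-/

noncomputable section

namespace Summit.CriticalPhenomena.PercolationContinuityZ3.Theorems.Transplant

namespace Grigorchuk

namespace SlabSuscept

open SimpleGraph MeasureTheory Filter Literature.Barriers.CriticalPhenomena Literature.Probability.Percolation SnowballSqueeze LROSqueeze
open scoped Classical ENNReal

/-! ## §1 Real arithmetic: the `j`-optimisation, the link length, the half-height -/

/-- **The `j`-optimisation, real form**: if `κ₀^{1−a} = c₁/(2β)` and `κ₀ n^{a/(1−a)}/2 ≤ j ≤ κ₀ n^{a/(1−a)}` then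
`½c₁ (κ₀/2)^a n^{a/(1−a)} ≤ c₁ (j n)^a − β j` (`βj = β j^{1−a} j^a ≤ ½c₁ n^a j^a`). [cite: Hutchcroft2016, §2 (optimisation in the proof of Thm. 2)] -/
theorem jopt_real {a c₁ β n κ₀ j : ℝ} (ha : 0 < a) (ha1 : a < 1) (hc₁ : 0 < c₁) (hβ : 0 < β) (hn : 0 < n) (hκ₀ : 0 < κ₀)
    (hκ : κ₀ ^ (1 - a) = c₁ / (2 * β)) (hj : 0 < j) (hjJ : j ≤ κ₀ * n ^ (a / (1 - a))) (hJj : κ₀ * n ^ (a / (1 - a)) / 2 ≤ j) :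
    c₁ / 2 * (κ₀ / 2) ^ a * n ^ (a / (1 - a)) ≤ c₁ * (j * n) ^ a - β * j := by
  obtain ⟨b, hb⟩ : ∃ b : ℝ, b = a / (1 - a) := ⟨_, rfl⟩
  rw [← hb] at hjJ hJj ⊢
  have h1a : 0 < 1 - a := by linarith
  have hba : b * (1 - a) = a := by rw [hb]; field_simp
  have hbab : b * a + a = b := by rw [hb]; field_simp; ring
  have hnb : 0 < n ^ b := Real.rpow_pos_of_pos hn b
  have hβ0 : β ≠ 0 := hβ.ne'
  obtain ⟨J, hJ⟩ : ∃ J : ℝ, J = κ₀ * n ^ b := ⟨_, rfl⟩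
  rw [← hJ] at hjJ hJj
  have hJpos : 0 < J := by rw [hJ]; exact mul_pos hκ₀ hnb
  -- `β j ≤ ½ c₁ j^a n^a`
  have hj1a : j ^ (1 - a) ≤ c₁ / (2 * β) * n ^ a := by
    calc j ^ (1 - a) ≤ J ^ (1 - a) := Real.rpow_le_rpow hj.le hjJ h1a.le
      _ = κ₀ ^ (1 - a) * (n ^ b) ^ (1 - a) := by rw [hJ]; exact Real.mul_rpow hκ₀.le hnb.le
      _ = c₁ / (2 * β) * n ^ a := by rw [hκ, ← Real.rpow_mul hn.le, hba]
  have hsplit : j = j ^ (1 - a) * j ^ a := by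
    rw [← Real.rpow_add hj, show (1 - a) + a = 1 by ring, Real.rpow_one]
  have hja : 0 < j ^ a := Real.rpow_pos_of_pos hj a
  have hna : 0 < n ^ a := Real.rpow_pos_of_pos hn a
  have hβj : β * j ≤ c₁ / 2 * (j ^ a * n ^ a) := by
    calc β * j = β * (j ^ (1 - a) * j ^ a) := by rw [← hsplit]
      _ ≤ β * (c₁ / (2 * β) * n ^ a * j ^ a) := mul_le_mul_of_nonneg_left (mul_le_mul_of_nonneg_right hj1a hja.le) hβ.le
      _ = c₁ / 2 * (j ^ a * n ^ a) := by field_simp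
  -- `(j n)^a = j^a n^a`, `j^a ≥ (J/2)^a`, `(J/2)^a n^a = (κ₀/2)^a n^b`
  have hjn : (j * n) ^ a = j ^ a * n ^ a := Real.mul_rpow hj.le hn.le
  have hJ2 : (κ₀ / 2) ^ a * n ^ b = (J / 2) ^ a * n ^ a := by
    rw [show J / 2 = κ₀ / 2 * n ^ b by rw [hJ]; ring, Real.mul_rpow (by positivity) hnb.le, ← Real.rpow_mul hn.le, mul_assoc,
      ← Real.rpow_add hn, hbab]
  have hjaJ : (J / 2) ^ a ≤ j ^ a := Real.rpow_le_rpow (by positivity) hJj ha.le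
  calc c₁ / 2 * (κ₀ / 2) ^ a * n ^ b = c₁ / 2 * ((J / 2) ^ a * n ^ a) := by rw [mul_assoc, hJ2]
    _ ≤ c₁ / 2 * (j ^ a * n ^ a) := mul_le_mul_of_nonneg_left (mul_le_mul_of_nonneg_right hjaJ hna.le) (by positivity)
    _ ≤ c₁ * (j * n) ^ a - β * j := by rw [hjn]; linarith

/-- **The `j`-optimisation**: with `j := ⌊κ₀ n^{a/(1−a)}⌋ ≥ 1` (when `κ₀ n^{a/(1−a)} ≥ 2`), `½c₁ (κ₀/2)^a n^{a/(1−a)} ≤ c₁ (j n)^a − βj`.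
[cite: Hutchcroft2016, §2 (optimisation in the proof of Thm. 2)] -/
theorem jopt {a c₁ β n κ₀ : ℝ} (ha : 0 < a) (ha1 : a < 1) (hc₁ : 0 < c₁) (hβ : 0 < β) (hn : 0 < n) (hκ₀ : 0 < κ₀)
    (hκ : κ₀ ^ (1 - a) = c₁ / (2 * β)) (hJ2 : 2 ≤ κ₀ * n ^ (a / (1 - a))) :
    ∃ j : ℕ, 1 ≤ j ∧ c₁ / 2 * (κ₀ / 2) ^ a * n ^ (a / (1 - a)) ≤ c₁ * ((j : ℝ) * n) ^ a - β * j := by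
  obtain ⟨J, hJ⟩ : ∃ J : ℝ, J = κ₀ * n ^ (a / (1 - a)) := ⟨_, rfl⟩
  rw [← hJ] at hJ2
  have hJ0 : 0 ≤ J := by linarith
  have hfloor : 1 ≤ ⌊J⌋₊ := Nat.le_floor (by exact_mod_cast (by linarith : (1 : ℝ) ≤ J))
  have hlt := Nat.lt_floor_add_one J
  refine ⟨⌊J⌋₊, hfloor, jopt_real ha ha1 hc₁ hβ hn hκ₀ hκ (by exact_mod_cast hfloor) ?_ ?_⟩
  · rw [← hJ]; exact Nat.floor_le hJ0
  · rw [← hJ]; linarith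

/-- The link length `n = ⌊log D / C⌋` has `e^{C n} ≤ D` (`D ≥ 1`, `C > 0`). [folklore] -/
theorem exp_mul_floor_le {C D : ℝ} (hC : 0 < C) (hD : 1 ≤ D) : Real.exp (C * (⌊Real.log D / C⌋₊ : ℕ)) ≤ D := by
  have hlog : 0 ≤ Real.log D := Real.log_nonneg hD
  have h1 : ((⌊Real.log D / C⌋₊ : ℕ) : ℝ) ≤ Real.log D / C := Nat.floor_le (div_nonneg hlog hC.le)
  calc Real.exp (C * _) ≤ Real.exp (Real.log D) := Real.exp_le_exp.2 (by rw [mul_comm]; exact (le_div_iff₀ hC).1 h1)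
    _ = D := Real.exp_log (by linarith)

/-- … and `n ≥ log D / (2C)` as soon as `log D ≥ 2C`. [folklore] -/
theorem le_floor_log_div {C D : ℝ} (hC : 0 < C) (h2 : 2 * C ≤ Real.log D) : Real.log D / (2 * C) ≤ ((⌊Real.log D / C⌋₊ : ℕ) : ℝ) := by
  have h1 := Nat.lt_floor_add_one (Real.log D / C)
  have hx : 2 ≤ Real.log D / C := by rw [le_div_iff₀ hC]; linarith
  have : Real.log D / (2 * C) = (Real.log D / C) / 2 := by rw [mul_comm, ← div_div]
  rw [this]
  linarith

/-- The half-height: for `L ≥ 4R₀ + 8`, `D := L/2 − R₀` (naturals) has `R₀ ≤ L/2`, `D ≥ (L+6)/4` and `log(L+2) ≤ 2 log D`. [folklore] -/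
theorem half_sub_control {L R₀ : ℕ} (hL : 4 * R₀ + 8 ≤ L) :
    R₀ ≤ L / 2 ∧ ((L : ℝ) + 6) / 4 ≤ ((L / 2 - R₀ : ℕ) : ℝ) ∧ Real.log ((L : ℝ) + 2) ≤ 2 * Real.log ((L / 2 - R₀ : ℕ) : ℝ) := by
  have h1 : R₀ ≤ L / 2 := by omega
  have hD : ((L : ℝ) + 6) / 4 ≤ ((L / 2 - R₀ : ℕ) : ℝ) := by
    have h4 : L + 6 ≤ 4 * (L / 2 - R₀) := by omega
    have : (L : ℝ) + 6 ≤ 4 * ((L / 2 - R₀ : ℕ) : ℝ) := by exact_mod_cast h4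
    linarith
  refine ⟨h1, hD, ?_⟩
  have hL0 : (0 : ℝ) ≤ L := Nat.cast_nonneg L
  have hDpos : 0 < ((L / 2 - R₀ : ℕ) : ℝ) := by linarith
  rw [show (2 : ℝ) * Real.log ((L / 2 - R₀ : ℕ) : ℝ) = Real.log (((L / 2 - R₀ : ℕ) : ℝ) ^ 2) by rw [Real.log_pow]; norm_num]
  refine Real.log_le_log (by linarith) ?_
  nlinarith [mul_self_le_mul_self (by positivity : (0 : ℝ) ≤ ((L : ℝ) + 6) / 4) hD, sq_nonneg ((L : ℝ) - 2)]

/-! ## §2 The engine E7, proved; door D12 as a theorem -/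

/-- **E7 — `SlabLogEngine o` holds at every vertex `o` of `Cay(𝔊 × ℤ; a,b,c,d,z)`** (PROVED; a typed implication — its hypotheses `GrowthLower stdCay 1 a`,
`VertGluedIfJumpExp o` and the jump `θ_o(p_c) > 0` are NOT asserted): under them there are `c > 0` and `L₀` with `exp(c (log(L+2))^{a/(1−a)}) ≤ B`
whenever `L ≥ L₀` and `SlabSusceptLE L B`, i.e. `log X(L) ≥ c (log(L+2))^{a/(1−a)}`.  See the module docstring for the chain (T3 profile inequality at half-height
`L/2` with link length `n ≍ log L` and the `j`-optimisation `j ≍ n^{a/(1−a)}`).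
[cite: Hutchcroft2016, Lemma 4 and §2] [cite: BenjaminiSchramm1996, Conj. 4 (context: door D12)] [cite: Grigorchuk1984, Thm. (lower growth bound)] -/
theorem slabLogEngine (o : GZ) : SlabLogEngine o := by
  intro a ha ha1 hG hV hθ
  obtain ⟨c₁, hc₁, hev⟩ := hG
  obtain ⟨m₁, hm₁⟩ := eventually_atTop.1 hev
  obtain ⟨C, R₀, hglue⟩ := hV hθ
  -- `q₀ = ¾θ²`, `β = −log q₀ > 0`
  obtain ⟨q₀, hq₀def⟩ : ∃ q₀ : ℝ, q₀ = 3 / 4 * theta gzCay o (criticalProbIOf gzCay o) ^ 2 := ⟨_, rfl⟩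
  have hθ1 : theta gzCay o (criticalProbIOf gzCay o) ≤ 1 := theta_le_one _ _ _
  have hq₀pos : 0 < q₀ := by rw [hq₀def]; positivity
  have hq₀lt : q₀ < 1 := by rw [hq₀def]; nlinarith
  obtain ⟨β, hβdef⟩ : ∃ β : ℝ, β = -Real.log q₀ := ⟨_, rfl⟩
  have hβ : 0 < β := by rw [hβdef, neg_pos]; exact Real.log_neg hq₀pos hq₀lt
  have hqexp : ∀ j : ℕ, q₀ ^ j = Real.exp (-(β * j)) := fun j => by
    rw [hβdef, show -(-Real.log q₀ * (j : ℝ)) = (j : ℝ) * Real.log q₀ by ring, Real.exp_nat_mul, Real.exp_log hq₀pos]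
  -- WLOG `C ≥ 1`
  obtain ⟨C₁, hC₁def⟩ : ∃ C₁ : ℝ, C₁ = max C 1 := ⟨_, rfl⟩
  have hC₁1 : 1 ≤ C₁ := hC₁def ▸ le_max_right _ _
  have hC₁pos : 0 < C₁ := by linarith
  have hCC₁ : C ≤ C₁ := hC₁def ▸ le_max_left _ _
  have h1a : 0 < 1 - a := by linarith
  obtain ⟨b, hbdef⟩ : ∃ b : ℝ, b = a / (1 - a) := ⟨_, rfl⟩
  have hb : 0 < b := by rw [hbdef]; exact div_pos ha h1a
  -- `κ₀^{1−a} = c₁/(2β)`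
  obtain ⟨κ₀, hκ₀def⟩ : ∃ κ₀ : ℝ, κ₀ = (c₁ / (2 * β)) ^ (1 - a)⁻¹ := ⟨_, rfl⟩
  have hκ₀ : 0 < κ₀ := by rw [hκ₀def]; exact Real.rpow_pos_of_pos (by positivity) _
  have hκ : κ₀ ^ (1 - a) = c₁ / (2 * β) := by rw [hκ₀def]; exact Real.rpow_inv_rpow (by positivity) h1a.ne'
  -- `κ₀ n^b ≥ 2` once `n ≥ ν := (2/κ₀)^{1/b}`
  obtain ⟨ν, hνdef⟩ : ∃ ν : ℝ, ν = (2 / κ₀) ^ b⁻¹ := ⟨_, rfl⟩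
  have hν0 : 0 ≤ ν := by rw [hνdef]; exact Real.rpow_nonneg (by positivity) _
  have hJ_of : ∀ n : ℕ, ν ≤ n → 2 ≤ κ₀ * (n : ℝ) ^ b := by
    intro n hn
    have h1 : 2 / κ₀ ≤ (n : ℝ) ^ b := by
      have := Real.rpow_le_rpow hν0 hn hb.le
      rwa [hνdef, Real.rpow_inv_rpow (by positivity) hb.ne'] at this
    rw [div_le_iff₀ hκ₀] at h1
    linarith
  -- thresholds: `M` on `n`, `T = 2C₁M` on `log D`, `L₀` on `L`
  obtain ⟨M, hMdef⟩ : ∃ M : ℝ, M = max (max (m₁ : ℝ) 1) ν := ⟨_, rfl⟩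
  have hM1 : 1 ≤ M := hMdef ▸ le_trans (le_max_right _ _) (le_max_left _ _)
  have hMm₁ : (m₁ : ℝ) ≤ M := hMdef ▸ le_trans (le_max_left _ _) (le_max_left _ _)
  have hMν : ν ≤ M := hMdef ▸ le_max_right _ _
  obtain ⟨T, hTdef⟩ : ∃ T : ℝ, T = 2 * C₁ * M := ⟨_, rfl⟩
  have hT2C : 2 * C₁ ≤ T := by rw [hTdef]; nlinarith
  have hT0 : 0 ≤ T := by linarith
  obtain ⟨c, hcdef⟩ : ∃ c : ℝ, c = c₁ / 2 * (κ₀ / 2) ^ a * (4 * C₁)⁻¹ ^ b := ⟨_, rfl⟩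
  have hcpos : 0 < c := by rw [hcdef]; positivity
  refine ⟨c, hcpos, max (4 * R₀ + 8) ⌈4 * Real.exp T⌉₊, fun L B hL hB => ?_⟩
  -- the half-height `D = L/2 − R₀`
  have hL1 : 4 * R₀ + 8 ≤ L := le_trans (le_max_left _ _) hL
  have hL2 : ((⌈4 * Real.exp T⌉₊ : ℕ) : ℝ) ≤ L := by exact_mod_cast le_trans (le_max_right _ _) hL
  obtain ⟨hR₀L, hDge, hlogL⟩ := half_sub_control hL1
  have hexpT : Real.exp T ≤ ((L / 2 - R₀ : ℕ) : ℝ) := by linarith [Nat.le_ceil (4 * Real.exp T)]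
  have hD1 : 1 ≤ ((L / 2 - R₀ : ℕ) : ℝ) := le_trans (by linarith [Real.add_one_le_exp T]) hexpT
  have hlogD : T ≤ Real.log ((L / 2 - R₀ : ℕ) : ℝ) := by rw [Real.le_log_iff_exp_le (by linarith)]; exact hexpT
  -- the link length `n`
  obtain ⟨n, hndef⟩ : ∃ n : ℕ, n = ⌊Real.log ((L / 2 - R₀ : ℕ) : ℝ) / C₁⌋₊ := ⟨_, rfl⟩
  have hn_lb : Real.log ((L / 2 - R₀ : ℕ) : ℝ) / (2 * C₁) ≤ n := hndef ▸ le_floor_log_div hC₁pos (hT2C.trans hlogD)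
  have hnM : M ≤ n := by
    have : M ≤ Real.log ((L / 2 - R₀ : ℕ) : ℝ) / (2 * C₁) := by
      rw [le_div_iff₀ (by positivity)]; linarith
    linarith
  have hn1 : (1 : ℝ) ≤ n := le_trans hM1 hnM
  have hnpos : (0 : ℝ) < n := by linarith
  have hnm₁ : m₁ ≤ n := by exact_mod_cast le_trans hMm₁ hnM
  have hnν : ν ≤ n := le_trans hMν hnM
  -- `R(n) ≤ L/2`, so `κ_{L/2}(n) ≥ q₀`
  have hexpn : Real.exp (C₁ * n) ≤ ((L / 2 - R₀ : ℕ) : ℝ) := hndef ▸ exp_mul_floor_le hC₁pos hD1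
  have hceil : ⌈Real.exp (C * n)⌉₊ ≤ L / 2 - R₀ :=
    Nat.ceil_le.2 ((Real.exp_le_exp.2 (mul_le_mul_of_nonneg_right hCC₁ hnpos.le)).trans hexpn)
  have hRn : ⌈Real.exp (C * n)⌉₊ + R₀ ≤ L / 2 := by omega
  have hκq : q₀ ≤ slabKappa (L / 2) n := hq₀def ▸ (hglue n).trans (slabKappa_mono hRn n)
  -- the profile inequality at `(L/2, n, j)` with the optimal `j`
  have hB2 : SlabSusceptLE (2 * (L / 2)) B := slabSusceptLE_anti_height hB (by omega)
  obtain ⟨j, hj1, hjopt⟩ := jopt ha ha1 hc₁ hβ hnpos hκ₀ hκ (hbdef ▸ hJ_of n hnν)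
  have hprof := slabProfileIneq (L / 2) n j hB2
  have hjn : m₁ ≤ j * n := le_trans hnm₁ (Nat.le_mul_of_pos_left n hj1)
  have hgrowth := hm₁ (j * n) hjn
  -- the exponent
  have hlog0 : 0 ≤ Real.log ((L : ℝ) + 2) := Real.log_nonneg (by have := Nat.cast_nonneg (α := ℝ) L; linarith)
  have hnL : Real.log ((L : ℝ) + 2) / (4 * C₁) ≤ n := by
    have : Real.log ((L : ℝ) + 2) / (4 * C₁) ≤ Real.log ((L / 2 - R₀ : ℕ) : ℝ) / (2 * C₁) := by
      rw [div_le_div_iff₀ (by positivity) (by positivity)]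
      nlinarith [hlogL, hC₁pos]
    linarith
  have h1 : c * Real.log ((L : ℝ) + 2) ^ (a / (1 - a)) ≤ c₁ * ((j : ℝ) * n) ^ a - β * j := by
    refine le_trans ?_ hjopt
    rw [← hbdef]
    have h2 : (Real.log ((L : ℝ) + 2) / (4 * C₁)) ^ b ≤ (n : ℝ) ^ b := Real.rpow_le_rpow (by positivity) hnL hb.le
    rw [Real.div_rpow hlog0 (by positivity)] at h2
    have h3 : c * Real.log ((L : ℝ) + 2) ^ b = c₁ / 2 * (κ₀ / 2) ^ a * (Real.log ((L : ℝ) + 2) ^ b / (4 * C₁) ^ b) := by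
      rw [hcdef, Real.inv_rpow (by positivity)]; ring
    rw [h3]
    exact mul_le_mul_of_nonneg_left h2 (by positivity)
  have h2 : Real.exp (c₁ * ((j : ℝ) * n) ^ a - β * j) = q₀ ^ j * Real.exp (c₁ * (((j * n : ℕ) : ℝ)) ^ a) := by
    rw [hqexp j, ← Real.exp_add, Nat.cast_mul]; ring_nf
  have hkey : Real.exp (c * Real.log ((L : ℝ) + 2) ^ (a / (1 - a))) ≤ slabKappa (L / 2) n ^ j * (ballVolume stdCay 1 (j * n) : ℝ) := by
    calc Real.exp (c * Real.log ((L : ℝ) + 2) ^ (a / (1 - a))) ≤ Real.exp (c₁ * ((j : ℝ) * n) ^ a - β * j) := Real.exp_le_exp.2 h1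
      _ = q₀ ^ j * Real.exp (c₁ * (((j * n : ℕ) : ℝ)) ^ a) := h2
      _ ≤ slabKappa (L / 2) n ^ j * (ballVolume stdCay 1 (j * n) : ℝ) :=
          mul_le_mul (pow_le_pow_left₀ hq₀pos.le hκq j) hgrowth (Real.exp_nonneg _) (pow_nonneg (slabKappa_nonneg _ _) j)
  exact (ENNReal.ofReal_le_ofReal hkey).trans hprof

/-- **DOOR D12 on `Cay(𝔊 × ℤ; a,b,c,d,z)` is a THEOREM for every growth exponent `a`** (T0 `doorD12_of_engine` ∘ `slabLogEngine`): a typed implication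
`0 < a < 1 → GrowthLower stdCay 1 a → (∀ x, VertGluedIfJumpExp x) → SlabSusceptQuasiPoly (a/(1−a)) → gzCay_conj4` whose hypotheses are NOT asserted —
`gzCay_conj4` stays OPEN. [cite: BenjaminiSchramm1996, Conj. 4 (context: door D12)] -/
theorem doorD12 (a : ℝ) : DoorD12 a :=
  doorD12_of_engine slabLogEngine a

end SlabSuscept

end Grigorchuk

end Summit.CriticalPhenomena.PercolationContinuityZ3.Theorems.Transplant
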